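import Summits.CriticalPhenomena.PercolationContinuityZ3.Theorems.Transplant.FreeSubmonoidExpGrowth
import Mathlib.Data.Nat.Digits.Defs
import HarnessLib

/-!
# `θ(p_c) = 0` on EVERY Cayley graph of the Baumslag–Solitar group `BS(1,2)` — a solvable, non-virtually-nilpotent, amenable group of exponential
# growth, as a concrete kernel customer (unconditional)

builds on p205010 (kernel theorem, internal audit signed; external expert review pending) — nothing in this file uses p205010; unconditional, no node.
Lane `prim-bschramm`, seat `prim-bschramm-p4` gen 22 (PART C3 of `P4-GENERAL.md` §44).  Helper file (`--supports stmt-CriticalPhenomena-4575 --as helper`).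

THE POINT.  `BS(1,2) = ⟨a, t | t a t⁻¹ = a²⟩` is realised faithfully as the affine group `⟨x ↦ x + 1, x ↦ 2x⟩ ≤ Perm ℚ` (`BS12.Grp`).  The affine maps
`x ↦ 2x` and `x ↦ 2x + 1` generate a FREE SUBMONOID: a positive word `w` acts by `x ↦ 2^{|w|} x + n_w` where `n_w` is the number with binary digits `w`
(`posWord_apply`), so the word is recovered from the map (`posWord_injective`, via `Nat.ofDigits_inj_of_len_eq`).  By gen 22's free-pair certificate
(`FreePair.criticalContinuity`): **`BS12.criticalContinuity_anyGens` — for every finite generating set `S` of `BS(1,2)` and every vertex `g`,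
`θ_g(p_c(Cay(BS(1,2); S))) = 0`**, unconditionally (exponential growth `BS12.hasExponentialGrowth_anyGens` + Hutchcroft 2016 Thm. 1 PROVED in the tree);
`p_c < 1` by `ExpGrowth.criticalProb_lt_one_of_hasExponentialGrowth`.  This is the class map's first SOLVABLE NON-VIRTUALLY-NILPOTENT kernel customer
(Rosenblatt: such groups always contain a free subsemigroup).
[cite: LyonsPeres2016, §7.4 Thm. 7.20 (exponential growth)] [cite: Hutchcroft2016, Thm. 1] [cite: BenjaminiSchramm1996, Conj. 4; §2 (Cayley graphs)]
[cite: MilnorSolvableGrowth1968, p. 447 (free semigroups in solvable groups of exponential growth)]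
-/

noncomputable section

namespace Summit.CriticalPhenomena.PercolationContinuityZ3.Theorems.Transplant
open SimpleGraph Literature.Probability.LatticeModels Literature.Probability.Percolation
open scoped Classical

namespace BS12

/-- `x ↦ x + 1` (the generator `a`). [folklore] -/
def addOne : Equiv.Perm ℚ where
  toFun x := x + 1
  invFun x := x - 1
  left_inv x := by simp
  right_inv x := by simp

/-- `x ↦ 2x` (the generator `t`). [folklore] -/
def double : Equiv.Perm ℚ where
  toFun x := 2 * x
  invFun x := x / 2
  left_inv x := by show 2 * x / 2 = x; ring
  right_inv x := by show 2 * (x / 2) = x; ring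

/-- `x ↦ 2x + 1 = addOne ∘ double`. [folklore] -/
def doubleAddOne : Equiv.Perm ℚ := addOne * double

/-- `addOne x = x + 1`. [folklore] -/
@[simp] theorem addOne_apply (x : ℚ) : addOne x = x + 1 := rfl
/-- `double x = 2x`. [folklore] -/
@[simp] theorem double_apply (x : ℚ) : double x = 2 * x := rfl
/-- `doubleAddOne x = 2x + 1`. [folklore] -/
@[simp] theorem doubleAddOne_apply (x : ℚ) : doubleAddOne x = 2 * x + 1 := rfl

/-- **`BS(1,2)` as the affine group `⟨x ↦ x + 1, x ↦ 2x⟩ ≤ Perm ℚ`** (a faithful representation of `⟨a, t | t a t⁻¹ = a²⟩`).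
[cite: LyonsPeres2016, §7.4 (solvable groups of exponential growth)] -/
abbrev Grp : Subgroup (Equiv.Perm ℚ) := Subgroup.closure {addOne, double}

/-- The defining relation `t a t⁻¹ = a²` holds in the representation. [folklore] -/
theorem relation : double * addOne * double⁻¹ = addOne * addOne := by
  ext x
  simp only [Equiv.Perm.coe_mul, Function.comp_apply, addOne_apply, double_apply]
  show 2 * (double.symm x + 1) = x + 1 + 1
  have : double.symm x = x / 2 := rfl
  rw [this]; ring

/-- The letters: `true ↦ (x ↦ 2x)`, `false ↦ (x ↦ 2x + 1)`; their digits `0`, `1`. [folklore] -/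
def letter (b : Bool) : Equiv.Perm ℚ := if b then double else doubleAddOne

/-- The digit of a letter. [folklore] -/
def digit (b : Bool) : ℕ := if b then 0 else 1

/-- **A positive word acts by `x ↦ 2^{|w|} x + n_w`**, `n_w` the number whose binary digits (least significant first) are the digits of `w`. [folklore] -/
theorem posWord_apply : ∀ (w : List Bool) (x : ℚ), (w.map letter).prod x = 2 ^ w.length * x + ((Nat.ofDigits (2 : ℕ) (w.map digit) : ℕ) : ℚ)
  | [], x => by simp
  | b :: w, x => by
    rw [List.map_cons, List.prod_cons, Equiv.Perm.coe_mul, Function.comp_apply, posWord_apply w x]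
    cases b <;> simp [letter, digit, Nat.ofDigits, pow_succ] <;> push_cast <;> ring

/-- **`x ↦ 2x` and `x ↦ 2x + 1` generate a free submonoid**: positive words are pairwise distinct permutations. [folklore] -/
theorem posWord_injective : Function.Injective fun w : List Bool => (w.map letter).prod := by
  intro w w' h
  have h' : (w.map letter).prod = (w'.map letter).prod := h
  have h0 := congrArg (fun σ : Equiv.Perm ℚ => σ 0) h'
  have h1 := congrArg (fun σ : Equiv.Perm ℚ => σ 1) h'
  simp only [posWord_apply, mul_zero, zero_add, mul_one] at h0 h1
  have hn : Nat.ofDigits 2 (w.map digit) = Nat.ofDigits 2 (w'.map digit) := by exact_mod_cast h0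
  have hlen' : (2 : ℚ) ^ w.length = 2 ^ w'.length := by rw [h0] at h1; linarith
  have hlen : w.length = w'.length := by
    have := (pow_right_injective₀ (by norm_num : (0 : ℚ) < 2) (by norm_num : (2 : ℚ) ≠ 1)) hlen'
    exact this
  have hdig : w.map digit = w'.map digit :=
    Nat.ofDigits_inj_of_len_eq (by norm_num) (by simpa using hlen)
      (fun l hl => by obtain ⟨b, -, rfl⟩ := List.mem_map.1 hl; cases b <;> simp [digit])
      (fun l hl => by obtain ⟨b, -, rfl⟩ := List.mem_map.1 hl; cases b <;> simp [digit]) hn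
  have hinj : Function.Injective digit := by
    intro b b' hb; cases b <;> cases b' <;> simp_all [digit]
  exact (List.map_injective_iff.2 hinj) hdig

/-- The letters lie in `BS(1,2)`. [folklore] -/
theorem letter_mem (b : Bool) : letter b ∈ Grp := by
  cases b
  · exact mul_mem (Subgroup.subset_closure (Set.mem_insert _ _)) (Subgroup.subset_closure (Set.mem_insert_of_mem _ rfl))
  · exact Subgroup.subset_closure (Set.mem_insert_of_mem _ rfl)

/-- The free pair inside `BS(1,2)` (as elements of the subgroup type). [folklore] -/
theorem posWord_injective_grp :
    Function.Injective fun w : List Bool => (w.map fun b => if b then (⟨double, letter_mem true⟩ : Grp) else ⟨doubleAddOne, letter_mem false⟩).prod := by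
  intro w w' h
  apply posWord_injective
  have key : ∀ w : List Bool,
      (((w.map fun b => if b then (⟨double, letter_mem true⟩ : Grp) else ⟨doubleAddOne, letter_mem false⟩).prod : Grp) : Equiv.Perm ℚ) =
        (w.map letter).prod := by
    intro w
    rw [SubmonoidClass.coe_list_prod, List.map_map]
    congr 1
    apply List.map_congr_left
    intro b _
    cases b <;> rfl
  have h' := congrArg (fun x : Grp => (x : Equiv.Perm ℚ)) h
  simp only [key] at h'
  exact h'

/-- **Every Cayley graph of `BS(1,2)` has exponential growth.** [cite: LyonsPeres2016, §7.4 Thm. 7.20] [cite: MilnorSolvableGrowth1968, p. 447] -/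
theorem hasExponentialGrowth_anyGens (S : Finset Grp) (hS : Subgroup.closure (S : Set Grp) = ⊤) :
    Literature.Barriers.CriticalPhenomena.HasExponentialGrowth (mulCayley (↑S : Set Grp)) :=
  FreePair.hasExponentialGrowth S hS posWord_injective_grp

/-- **THEOREM (unconditional, kernel): `θ_g(p_c) = 0` on every Cayley graph of `BS(1,2)`** — every finite generating set, every vertex.
[cite: Hutchcroft2016, Thm. 1] [cite: BenjaminiSchramm1996, Conj. 4; §2 (Cayley graphs)] -/
theorem criticalContinuity_anyGens (S : Finset Grp) (hS : Subgroup.closure (S : Set Grp) = ⊤) (g : Grp) :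
    theta (mulCayley (↑S : Set Grp)) g (criticalProbIOf (mulCayley (↑S : Set Grp)) g) = 0 :=
  FreePair.criticalContinuity S hS posWord_injective_grp g

end BS12

end Summit.CriticalPhenomena.PercolationContinuityZ3.Theorems.Transplant
end
-- build-touch 2026-08-25T07:58:17Z T1-B (lead g18): re-land of p391821, declarations byte-identical
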